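import Summits.RiemannHypothesis.RiemannHypothesis.Theorems.UniversalFactorLaplaceLoopholeInterlacing
import Summits.RiemannHypothesis.RiemannHypothesis.Theorems.UniversalFactorNarrowPigeonhole
import Summits.RiemannHypothesis.RiemannHypothesis.Theorems.UniversalFactorNarrowKernelNoGoOrdinateZero
import Summits.RiemannHypothesis.RiemannHypothesis.Theorems.UniversalFactorNarrowKernelNoGoConvolution
import Summits.RiemannHypothesis.RiemannHypothesis.Theorems.UniversalFactorNarrowKernelNoGoShortWindow
import Summits.RiemannHypothesis.RiemannHypothesis.Theorems.UniversalFactorNarrowKernelNoGoEnvelope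
import Summits.RiemannHypothesis.RiemannHypothesis.Theorems.UniversalFactorNarrowKernelNoGoEnergyLowerReduction
import Literature.NumberTheory.LFunctions.RiemannSiegel
import Literature.NumberTheory.LFunctions.DobnerNewman
import Mathlib.Analysis.SpecialFunctions.Pow.Deriv

/-!
# RiemannHypothesis / UniversalFactor — `NarrowKernelNoGo` (stmt-RiemannHypothesis-2576):
skeleton of line `Sketch` (two-step Laguerre interlacing ≈ Lorentz-filter energy gap)

Crux (rank 2): for every `a ≥ 32` the Laplace(a)-smoothed Riemann kernel transform
`F_a(z) = ∫₀^∞ Φ(u)(1 + u²/a²)⁻¹ cos(zu) du = deBruijnHDiv (1 + u²/a²) z` has a non-real zero.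

Proof by contradiction (all of it on the real axis). Assume `X(a)`: all zeros of `F_a` are real.

1. RH for free: `X(a) ⇒ H_0` has only real zeros (`UniversalFactor.laguerreLift`, PROVED) `⇔ RH`
   (`riemannHypothesis_iff_hasOnlyRealZeros_deBruijnH_zero_holds`, PROVED).
2. Convolution (stub `stub_narrowConvolution`): on the critical line `x = 2t`,
   `F_a(2t) = −(a/8) ∫ℝ e^{−2a|u|} E(t+u) Z(t+u) du` with `E(τ) = ‖γ(1/2+iτ)‖`
   (`γ = xiGammaFactor`, `ξ = γ ζ`, `ξ(1/2+iτ) = −E(τ) Z(τ)`), `Z = hardyZ`; and the `t`-derivative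
   falls on the kernel (`2a·sgn(u) e^{−2a|u|}`).
3. Log-free energy budget (stubs `stub_narrowEnergyLower`, `stub_narrowEnergyUpper`): with the weight
   `w(t) = t^{-7/4} e^{πt/4}` (so that `E(t+u) w(t) ≈ e^{−πu/4}`), the real trace
   `R_a(t) = F_a(2t) w(t)` has `∫_T^{2T} R_a² ≥ c T` and `∫_T^{2T+1} R_a'² ≤ C T` — NO `log T`,
   because the Lorentz filter `k̂(ω) = 4a/(4a² + ω²)`-type weights make `Σ_n |k̂(log(N/n))|²/n` and
   `Σ_n |ω k̂|²/n` converge (Montgomery–Vaughan + `Z = z₁ + z̄₁ + e`).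
4. L²-pigeonhole (`UniversalFactor.exists_window_forall_ne_zero`, PROVED): hence for every large `T`
   some window `[t₁, t₁ + 2h] ⊆ [T, 2T+1]` of FIXED length is free of zeros of `R_a`, i.e. of `F_a(2·)`.
5. Zeta side under RH (stubs `stub_narrowShortWindow`, `stub_narrowOrdinateZero`): every window of fixed
   length eventually carries a zeta zero (Goldston–Gonek lower count / Littlewood), and a jump of `N(t)`
   under RH is an ordinate `γ` with `H_0(2γ) = 0`; three consecutive windows of length `2h/3` give
   three real zeros `2γ₁ < 2γ₂ < 2γ₃` of `H_0` inside `[2t₁, 2t₁ + 4h]`.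
6. Laguerre interlacing (`UniversalFactor.not_three_zeros_of_zeroFree`, PROVED): under `X(a)` a
   zero-free interval of `F_a` carries at most two zeros of `H_0`. Contradiction.

The composition `UniversalFactor.NarrowKernelNoGo_of` is proved here modulo the six stubs; the stubs are
the registered work units of the line (lead: prover-line-stmt-RiemannHypothesis-2576-0).

References: crux idea cards `two-step-laguerre-interlacing`, `lorentz-filter-energy-gap`
(Cruxes/NarrowKernelNoGo/Ideas); Titchmarsh, *The Theory of the Riemann Zeta-Function* (1986) §7.2–7.4,
§9.20–9.23, Thm. 9.12, Thm. 14.13; Balazard–de Roton 2008 Prop. 15–16; Montgomery–Vaughan 1974.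
-/

noncomputable section

-- D-0017: `Summit.<S>.<S>.…` is the designed namespace of a single-problem summit.
set_option linter.dupNamespace false

namespace Summit.RiemannHypothesis.RiemannHypothesis.Theorems

open MeasureTheory Set Filter Complex intervalIntegral
open scoped Real Topology
open Literature.NumberTheory.LFunctions
open Summit.RiemannHypothesis.RiemannHypothesis.Theses

/-! ## The stubs (registered work units of the line); `stub_narrowConvolution` (p87942),
`stub_narrowShortWindow` (p88099), `stub_narrowOrdinateZero` (p86719), `stub_narrowEnvelope` (p90376) and
`stub_narrowEnergyLowerReduction` (p90486) have LANDED and are imported. -/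

/-- **Stub K1a-clean (log-free energy of the CLEAN Lorentz-filtered Hardy function, lower bound).**
For `a > π/8` and the tilted kernel `κ_a(u) = e^{−2a|u|} e^{−πu/4}`, the smoothed Hardy function
`g(t) = ∫ℝ κ_a(u) Z(t+u) du` has mean square `≫ T` on `[T, 2T]`: `c₁ T ≤ ∫_T^{2T} g²` for `T ≥ T₁`
(duality against `E₁(t) Σ_{N/e² < ν ≤ N/e} κ̂(log(N/ν)) ν^{-1/2-it}`, Montgomery–Vaughan, the
non-stationary cross term by van der Corput, `Z = z₁ + z̄₁ + e`). [folklore] -/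
theorem UniversalFactor.stub_narrowEnergyLowerClean :
    ∀ a : ℝ, π / 8 < a → ∃ c₁ T₁ : ℝ, 0 < c₁ ∧ ∀ T : ℝ, T₁ ≤ T →
      c₁ * T ≤ ∫ t in T..2 * T,
        (∫ u : ℝ, Real.exp (-(2 * a * |u|)) * Real.exp (-(π * u / 4)) * hardyZ (t + u)) ^ 2 := by
  sorry

/-- **K1a (log-free energy, lower bound)** — registered stub `stub_narrowEnergyLower`, here obtained from
the two registered sub-stubs `stub_narrowEnergyLowerClean` and `stub_narrowEnergyLowerReduction`.
For `a > π/8` the Lorentz-filtered Hardy function `t ↦ (∫ℝ e^{−2a|u|} E(t+u) Z(t+u) du) · t^{-7/4} e^{πt/4}`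
has mean square `≫ T` on `[T, 2T]`. [folklore] -/
theorem UniversalFactor.stub_narrowEnergyLower :
    ((∃ C₀ : ℝ, ∀ τ : ℝ, ‖xiGammaFactor (1 / 2 + (τ : ℂ) * I)‖ ≤
        C₀ * (1 + |τ|) ^ ((7 : ℝ) / 4) * Real.exp (-(π * |τ| / 4))) ∧
      (∃ c₀ C T₀ : ℝ, 0 < c₀ ∧ ∀ t : ℝ, T₀ ≤ t → ∀ u : ℝ, |u| ≤ t / 2 →
        |‖xiGammaFactor (1 / 2 + ((t + u : ℝ) : ℂ) * I)‖ * (t ^ (-(7 : ℝ) / 4) * Real.exp (π * t / 4)) -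
            c₀ * Real.exp (-(π * u / 4))| ≤ C * Real.exp (-(π * u / 4)) * (1 + |u|) / t)) →
    ∀ a : ℝ, π / 8 < a → ∃ c T₁ : ℝ, 0 < c ∧
    ∀ T : ℝ, T₁ ≤ T →
      c * T ≤ ∫ t in T..2 * T,
        ((∫ u : ℝ, Real.exp (-(2 * a * |u|)) *
            ‖xiGammaFactor (1 / 2 + ((t + u : ℝ) : ℂ) * I)‖ * hardyZ (t + u)) *
          (t ^ (-(7 : ℝ) / 4) * Real.exp (π * t / 4))) ^ 2 :=
  fun henv => UniversalFactor.stub_narrowEnergyLowerReduction UniversalFactor.stub_narrowEnergyLowerClean henv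

/-- **Stub K1b (log-free energy, upper bound for the derivative).** For `a > π/8`, with
`I₀(t) = ∫ℝ e^{−2a|u|} E(t+u) Z(t+u) du`, `I₁(t) = ∫ℝ 2a·sgn(u) e^{−2a|u|} E(t+u) Z(t+u) du` and
`w(t) = t^{-7/4} e^{πt/4}`, `w' = w · (π/4 − 7/(4t))`, the derivative `I₁ w + I₀ w'` of `I₀ w` has
mean square `≪ T`: `∫_T^{2T+1} (I₁ w + I₀ w')² dt ≤ C T` for `T ≥ T₁` (the kernel
`2a·sgn(u)e^{−2a|u|}` is bounded with a jump, `|k̂₁(ω)| ≍ 4a/|ω|`, so `Σ_n |k̂₁(log(N/n))|²/n`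
converges: no `log T`). [folklore] -/
theorem UniversalFactor.stub_narrowEnergyUpper :
    ((∃ C₀ : ℝ, ∀ τ : ℝ, ‖xiGammaFactor (1 / 2 + (τ : ℂ) * I)‖ ≤
        C₀ * (1 + |τ|) ^ ((7 : ℝ) / 4) * Real.exp (-(π * |τ| / 4))) ∧
      (∃ c₀ C T₀ : ℝ, 0 < c₀ ∧ ∀ t : ℝ, T₀ ≤ t → ∀ u : ℝ, |u| ≤ t / 2 →
        |‖xiGammaFactor (1 / 2 + ((t + u : ℝ) : ℂ) * I)‖ * (t ^ (-(7 : ℝ) / 4) * Real.exp (π * t / 4)) -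
            c₀ * Real.exp (-(π * u / 4))| ≤ C * Real.exp (-(π * u / 4)) * (1 + |u|) / t)) →
    ∀ a : ℝ, π / 8 < a → ∃ C T₁ : ℝ,
    ∀ T : ℝ, T₁ ≤ T →
      ∫ t in T..(2 * T + 1),
        ((∫ u : ℝ, (2 * a * Real.sign u) * Real.exp (-(2 * a * |u|)) *
            ‖xiGammaFactor (1 / 2 + ((t + u : ℝ) : ℂ) * I)‖ * hardyZ (t + u)) *
          (t ^ (-(7 : ℝ) / 4) * Real.exp (π * t / 4)) +
         (∫ u : ℝ, Real.exp (-(2 * a * |u|)) *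
            ‖xiGammaFactor (1 / 2 + ((t + u : ℝ) : ℂ) * I)‖ * hardyZ (t + u)) *
          (t ^ (-(7 : ℝ) / 4) * Real.exp (π * t / 4) * (π / 4 - 7 / (4 * t)))) ^ 2 ≤ C * T := by
  sorry

/-! ## The composition: the five stubs imply the crux -/

/-- Choice of the window half-length: for `c > 0` there is `h` with `0 < h`, `2h ≤ 1` and
`4h²C < c`. [folklore] -/
theorem UniversalFactor.narrow_exists_halfLength {c : ℝ} (hc : 0 < c) (C : ℝ) :
    ∃ h : ℝ, 0 < h ∧ 2 * h ≤ 1 ∧ 4 * h ^ 2 * C < c := by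
  rcases le_or_gt C 0 with hC | hC
  · refine ⟨1 / 2, by norm_num, by norm_num, ?_⟩
    have : 4 * (1 / 2 : ℝ) ^ 2 * C ≤ 0 := by
      have h4 : (0 : ℝ) ≤ 4 * (1 / 2 : ℝ) ^ 2 := by norm_num
      exact mul_nonpos_of_nonneg_of_nonpos h4 hC
    linarith
  · refine ⟨min (1 / 2) (c / (4 * C)), lt_min (by norm_num) (by positivity), ?_, ?_⟩
    · have := min_le_left (1 / 2 : ℝ) (c / (4 * C)); linarith
    · set h := min (1 / 2) (c / (4 * C)) with hh
      have h0 : 0 < h := lt_min (by norm_num) (by positivity)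
      have h1 : h ≤ 1 / 2 := min_le_left _ _
      have h2 : h ≤ c / (4 * C) := min_le_right _ _
      have h3 : h ^ 2 ≤ h * (1 / 2) := by nlinarith
      have h4 : 4 * h * C ≤ c := by
        have := mul_le_mul_of_nonneg_right h2 (by positivity : (0 : ℝ) ≤ 4 * C)
        rw [div_mul_cancel₀ _ (by positivity : (4 * C : ℝ) ≠ 0)] at this
        linarith
      nlinarith

/-- The weight `w(t) = t^{-7/4} e^{πt/4}` has derivative `w(t) (π/4 − 7/(4t))` at `t > 0`. [folklore] -/
theorem UniversalFactor.narrow_hasDerivAt_weight {t : ℝ} (ht : 0 < t) :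
    HasDerivAt (fun s : ℝ => s ^ (-(7 : ℝ) / 4) * Real.exp (π * s / 4))
      (t ^ (-(7 : ℝ) / 4) * Real.exp (π * t / 4) * (π / 4 - 7 / (4 * t))) t := by
  have h1 : HasDerivAt (fun s : ℝ => s ^ (-(7 : ℝ) / 4)) (-(7 : ℝ) / 4 * t ^ (-(7 : ℝ) / 4 - 1)) t :=
    Real.hasDerivAt_rpow_const (Or.inl ht.ne')
  have h2 : HasDerivAt (fun s : ℝ => Real.exp (π * s / 4)) (Real.exp (π * t / 4) * (π / 4)) t := by
    have h : HasDerivAt (fun s : ℝ => π * s / 4) (π / 4) t := by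
      simpa using ((hasDerivAt_id t).const_mul π).div_const 4
    exact h.exp
  have h3 := h1.mul h2
  refine h3.congr_deriv ?_
  have hpow : t ^ (-(7 : ℝ) / 4 - 1) = t ^ (-(7 : ℝ) / 4) * t⁻¹ := by
    rw [Real.rpow_sub_one ht.ne', div_eq_mul_inv]
  rw [hpow]
  field_simp
  ring

/-- **Composition of the line.** The six stubs imply the crux `NarrowKernelNoGo`: for every `a ≥ 32`,
`F_a` has a non-real zero. (RH for free from `laguerreLift`; L²-pigeonhole on the real trace
`R_a(t) = F_a(2t) t^{-7/4} e^{πt/4}`; three zeta ordinates in the zero-free window; Laguerre interlacing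
`not_three_zeros_of_zeroFree`.) [folklore] -/
theorem UniversalFactor.NarrowKernelNoGo_of
    (hconv : ∀ a : ℝ, π / 8 < a → ∀ t : ℝ,
      ((deBruijnHDiv (fun u : ℝ => 1 + u ^ 2 / a ^ 2) ((2 * t : ℝ) : ℂ)).re =
        -(a / 8) * ∫ u : ℝ, Real.exp (-(2 * a * |u|)) *
          ‖xiGammaFactor (1 / 2 + ((t + u : ℝ) : ℂ) * I)‖ * hardyZ (t + u)) ∧
      HasDerivAt (fun s : ℝ => (deBruijnHDiv (fun u : ℝ => 1 + u ^ 2 / a ^ 2) ((2 * s : ℝ) : ℂ)).re)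
        (-(a / 8) * ∫ u : ℝ, (2 * a * Real.sign u) * Real.exp (-(2 * a * |u|)) *
          ‖xiGammaFactor (1 / 2 + ((t + u : ℝ) : ℂ) * I)‖ * hardyZ (t + u)) t ∧
      Continuous (fun s : ℝ => ∫ u : ℝ, (2 * a * Real.sign u) * Real.exp (-(2 * a * |u|)) *
          ‖xiGammaFactor (1 / 2 + ((s + u : ℝ) : ℂ) * I)‖ * hardyZ (s + u)))
    (henv : ((∃ C₀ : ℝ, ∀ τ : ℝ, ‖xiGammaFactor (1 / 2 + (τ : ℂ) * I)‖ ≤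
        C₀ * (1 + |τ|) ^ ((7 : ℝ) / 4) * Real.exp (-(π * |τ| / 4))) ∧
      (∃ c₀ C T₀ : ℝ, 0 < c₀ ∧ ∀ t : ℝ, T₀ ≤ t → ∀ u : ℝ, |u| ≤ t / 2 →
        |‖xiGammaFactor (1 / 2 + ((t + u : ℝ) : ℂ) * I)‖ * (t ^ (-(7 : ℝ) / 4) * Real.exp (π * t / 4)) -
            c₀ * Real.exp (-(π * u / 4))| ≤ C * Real.exp (-(π * u / 4)) * (1 + |u|) / t)))
    (hlow : ((∃ C₀ : ℝ, ∀ τ : ℝ, ‖xiGammaFactor (1 / 2 + (τ : ℂ) * I)‖ ≤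
        C₀ * (1 + |τ|) ^ ((7 : ℝ) / 4) * Real.exp (-(π * |τ| / 4))) ∧
      (∃ c₀ C T₀ : ℝ, 0 < c₀ ∧ ∀ t : ℝ, T₀ ≤ t → ∀ u : ℝ, |u| ≤ t / 2 →
        |‖xiGammaFactor (1 / 2 + ((t + u : ℝ) : ℂ) * I)‖ * (t ^ (-(7 : ℝ) / 4) * Real.exp (π * t / 4)) -
            c₀ * Real.exp (-(π * u / 4))| ≤ C * Real.exp (-(π * u / 4)) * (1 + |u|) / t)) →
      ∀ a : ℝ, π / 8 < a → ∃ c T₁ : ℝ, 0 < c ∧ ∀ T : ℝ, T₁ ≤ T →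
      c * T ≤ ∫ t in T..2 * T,
        ((∫ u : ℝ, Real.exp (-(2 * a * |u|)) *
            ‖xiGammaFactor (1 / 2 + ((t + u : ℝ) : ℂ) * I)‖ * hardyZ (t + u)) *
          (t ^ (-(7 : ℝ) / 4) * Real.exp (π * t / 4))) ^ 2)
    (hup : ((∃ C₀ : ℝ, ∀ τ : ℝ, ‖xiGammaFactor (1 / 2 + (τ : ℂ) * I)‖ ≤
        C₀ * (1 + |τ|) ^ ((7 : ℝ) / 4) * Real.exp (-(π * |τ| / 4))) ∧
      (∃ c₀ C T₀ : ℝ, 0 < c₀ ∧ ∀ t : ℝ, T₀ ≤ t → ∀ u : ℝ, |u| ≤ t / 2 →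
        |‖xiGammaFactor (1 / 2 + ((t + u : ℝ) : ℂ) * I)‖ * (t ^ (-(7 : ℝ) / 4) * Real.exp (π * t / 4)) -
            c₀ * Real.exp (-(π * u / 4))| ≤ C * Real.exp (-(π * u / 4)) * (1 + |u|) / t)) →
      ∀ a : ℝ, π / 8 < a → ∃ C T₁ : ℝ, ∀ T : ℝ, T₁ ≤ T →
      ∫ t in T..(2 * T + 1),
        ((∫ u : ℝ, (2 * a * Real.sign u) * Real.exp (-(2 * a * |u|)) *
            ‖xiGammaFactor (1 / 2 + ((t + u : ℝ) : ℂ) * I)‖ * hardyZ (t + u)) *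
          (t ^ (-(7 : ℝ) / 4) * Real.exp (π * t / 4)) +
         (∫ u : ℝ, Real.exp (-(2 * a * |u|)) *
            ‖xiGammaFactor (1 / 2 + ((t + u : ℝ) : ℂ) * I)‖ * hardyZ (t + u)) *
          (t ^ (-(7 : ℝ) / 4) * Real.exp (π * t / 4) * (π / 4 - 7 / (4 * t)))) ^ 2 ≤ C * T)
    (hwin : _root_.RiemannHypothesis → ∀ h : ℝ, 0 < h →
      ∃ T₂ : ℝ, ∀ t : ℝ, T₂ ≤ t → zetaZeroCount t < zetaZeroCount (t + h))
    (hord : _root_.RiemannHypothesis → ∀ t₁ t₂ : ℝ, t₁ ≤ t₂ → zetaZeroCount t₁ < zetaZeroCount t₂ →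
      ∃ γ : ℝ, t₁ < γ ∧ γ ≤ t₂ ∧ deBruijnH 0 ((2 * γ : ℝ) : ℂ) = 0) :
    UniversalFactor.NarrowKernelNoGo := by
  intro a ha hX
  change HasOnlyRealZeros (deBruijnHDiv fun u : ℝ => 1 + u ^ 2 / a ^ 2) at hX
  have ha0 : 0 < a := by linarith
  have haπ : π / 8 < a := by
    have := Real.pi_lt_four
    linarith
  -- (1) RH for free
  have hH0 : HasOnlyRealZeros (deBruijnH 0) := UniversalFactor.laguerreLift a ha0 hX
  have hRH : _root_.RiemannHypothesis := riemannHypothesis_iff_hasOnlyRealZeros_deBruijnH_zero_holds.2 hH0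
  -- (2)–(3) the energy budget and the half-length `h`
  obtain ⟨c, T₁, hc, hlow'⟩ := hlow henv a haπ
  obtain ⟨C, T₁', hup'⟩ := hup henv a haπ
  obtain ⟨h, hh, hh1, hhC⟩ := UniversalFactor.narrow_exists_halfLength hc C
  obtain ⟨T₂, hwin'⟩ := hwin hRH (2 * h / 3) (by positivity)
  -- the height
  set T : ℝ := max (max T₁ T₁') (max T₂ 1) with hTdef
  have hTT₁ : T₁ ≤ T := (le_max_left _ _).trans (le_max_left _ _)
  have hTT₁' : T₁' ≤ T := (le_max_right _ _).trans (le_max_left _ _)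
  have hTT₂ : T₂ ≤ T := (le_max_left _ _).trans (le_max_right _ _)
  have hT1 : (1 : ℝ) ≤ T := (le_max_right _ _).trans (le_max_right _ _)
  have hT0 : 0 < T := by linarith
  -- abbreviations
  set F : ℂ → ℂ := deBruijnHDiv fun u : ℝ => 1 + u ^ 2 / a ^ 2 with hFdef
  set I₀ : ℝ → ℝ := fun t => ∫ u : ℝ, Real.exp (-(2 * a * |u|)) *
      ‖xiGammaFactor (1 / 2 + ((t + u : ℝ) : ℂ) * I)‖ * hardyZ (t + u) with hI₀
  set I₁ : ℝ → ℝ := fun t => ∫ u : ℝ, (2 * a * Real.sign u) * Real.exp (-(2 * a * |u|)) *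
      ‖xiGammaFactor (1 / 2 + ((t + u : ℝ) : ℂ) * I)‖ * hardyZ (t + u) with hI₁
  set w : ℝ → ℝ := fun t => t ^ (-(7 : ℝ) / 4) * Real.exp (π * t / 4) with hw
  set R : ℝ → ℝ := fun t => (F ((2 * t : ℝ) : ℂ)).re * w t with hR
  set R' : ℝ → ℝ := fun t => -(a / 8) * (I₁ t * w t + I₀ t * (w t * (π / 4 - 7 / (4 * t)))) with hR'
  have hconv' := hconv a haπ
  have hFre : ∀ t : ℝ, (F ((2 * t : ℝ) : ℂ)).re = -(a / 8) * I₀ t := fun t => (hconv' t).1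
  -- derivative of `R`
  have hderiv : ∀ t ∈ Icc T (2 * T + 1), HasDerivAt R (R' t) t := by
    intro t ht
    have ht0 : 0 < t := by linarith [ht.1]
    have h1 : HasDerivAt (fun s : ℝ => (F ((2 * s : ℝ) : ℂ)).re) (-(a / 8) * I₁ t) t := (hconv' t).2.1
    have h2 := UniversalFactor.narrow_hasDerivAt_weight ht0
    have h3 := h1.mul h2
    refine h3.congr_deriv ?_
    simp only [hR', hFre t, hw]
    ring
  -- continuity of `R'`
  have hI₁c : Continuous I₁ := (hconv' 0).2.2
  have hI₀c : Continuous I₀ := by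
    have hFc : Continuous fun t : ℝ => (F ((2 * t : ℝ) : ℂ)).re := by
      have hFd : Differentiable ℂ F := differentiable_deBruijnHDiv_laplace a
      have : Continuous fun t : ℝ => F ((2 * t : ℝ) : ℂ) :=
        hFd.continuous.comp (by fun_prop)
      exact Complex.continuous_re.comp this
    have heq : I₀ = fun t => (-(8 / a)) * (F ((2 * t : ℝ) : ℂ)).re := by
      funext t
      rw [hFre t]
      field_simp
    rw [heq]
    exact continuous_const.mul hFc
  have hwc : ContinuousOn w (Icc T (2 * T + 1)) := by
    intro t ht
    have ht0 : 0 < t := by linarith [ht.1]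
    have h1 : ContinuousAt (fun s : ℝ => s ^ (-(7 : ℝ) / 4)) t :=
      Real.continuousAt_rpow_const _ _ (Or.inl ht0.ne')
    have h2 : ContinuousAt (fun s : ℝ => Real.exp (π * s / 4)) t := by fun_prop
    exact (h1.mul h2).continuousWithinAt
  have hqc : ContinuousOn (fun t : ℝ => π / 4 - 7 / (4 * t)) (Icc T (2 * T + 1)) := by
    intro t ht
    have ht0 : (4 * t : ℝ) ≠ 0 := by have := ht.1; exact ne_of_gt (by linarith)
    exact (continuousAt_const.sub (continuousAt_const.div (by fun_prop) ht0)).continuousWithinAt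
  have hR'c : ContinuousOn R' (Icc T (2 * T + 1)) := by
    simp only [hR']
    exact continuousOn_const.mul
      ((hI₁c.continuousOn.mul hwc).add (hI₀c.continuousOn.mul (hwc.mul hqc)))
  -- the two energy bounds for `R`
  have hlowR : (a / 8) ^ 2 * c * T ≤ ∫ t in T..2 * T, R t ^ 2 := by
    have h1 := hlow' T hTT₁
    have heq : ∫ t in T..2 * T, R t ^ 2 = (a / 8) ^ 2 * ∫ t in T..2 * T, (I₀ t * w t) ^ 2 := by
      rw [← intervalIntegral.integral_const_mul]
      refine intervalIntegral.integral_congr fun t _ => ?_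
      simp only [hR, hFre t]
      ring
    rw [heq, mul_assoc]
    exact mul_le_mul_of_nonneg_left h1 (by positivity)
  have hupR : ∫ t in T..(2 * T + 1), R' t ^ 2 ≤ (a / 8) ^ 2 * C * T := by
    have h1 := hup' T hTT₁'
    have heq : ∫ t in T..(2 * T + 1), R' t ^ 2 =
        (a / 8) ^ 2 * ∫ t in T..(2 * T + 1),
          (I₁ t * w t + I₀ t * (w t * (π / 4 - 7 / (4 * t)))) ^ 2 := by
      rw [← intervalIntegral.integral_const_mul]
      refine intervalIntegral.integral_congr fun t _ => ?_
      simp only [hR']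
      ring
    have h1' : ∫ t in T..(2 * T + 1), (I₁ t * w t + I₀ t * (w t * (π / 4 - 7 / (4 * t)))) ^ 2 ≤ C * T := by
      simpa only [hI₁, hI₀, hw, mul_assoc] using h1
    rw [heq, mul_assoc]
    exact mul_le_mul_of_nonneg_left h1' (by positivity)
  -- (4) the pigeonhole: a zero-free window of `R`
  have hhC' : 4 * h ^ 2 * ((a / 8) ^ 2 * C) < (a / 8) ^ 2 * c := by
    have ha8 : (0 : ℝ) < (a / 8) ^ 2 := by positivity
    nlinarith
  obtain ⟨t₁, ht₁T, ht₁2T, hne⟩ := UniversalFactor.exists_window_forall_ne_zero hT0 hh hh1 hhC'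
    hderiv hR'c hlowR hupR
  -- (5) three ordinates in `(t₁, t₁ + 2h]`
  have ht₁T₂ : T₂ ≤ t₁ := hTT₂.trans ht₁T
  have hstep : 0 < 2 * h / 3 := by positivity
  obtain ⟨γ₁, hγ₁l, hγ₁r, hz₁⟩ := hord hRH t₁ (t₁ + 2 * h / 3) (by linarith) (hwin' t₁ ht₁T₂)
  obtain ⟨γ₂, hγ₂l, hγ₂r, hz₂⟩ := hord hRH (t₁ + 2 * h / 3) (t₁ + 2 * h / 3 + 2 * h / 3) (by linarith)
    (hwin' (t₁ + 2 * h / 3) (by linarith))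
  obtain ⟨γ₃, hγ₃l, hγ₃r, hz₃⟩ := hord hRH (t₁ + 2 * h / 3 + 2 * h / 3)
    (t₁ + 2 * h / 3 + 2 * h / 3 + 2 * h / 3) (by linarith)
    (hwin' (t₁ + 2 * h / 3 + 2 * h / 3) (by linarith))
  -- (6) Laguerre interlacing on `[2t₁, 2(t₁ + 2h)]`
  have hFI : ∀ x ∈ Icc (2 * t₁) (2 * (t₁ + 2 * h)), F x ≠ 0 := by
    intro x hx hFx
    have hx2 : x / 2 ∈ Icc t₁ (t₁ + 2 * h) := ⟨by linarith [hx.1], by linarith [hx.2]⟩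
    have hRx := hne (x / 2) hx2
    apply hRx
    simp only [hR]
    have : ((2 * (x / 2) : ℝ) : ℂ) = (x : ℂ) := by push_cast; ring
    rw [this, hFx, Complex.zero_re, zero_mul]
  have h₁ : (2 * γ₁ : ℝ) ∈ Icc (2 * t₁) (2 * (t₁ + 2 * h)) := ⟨by linarith, by linarith⟩
  have h₃ : (2 * γ₃ : ℝ) ∈ Icc (2 * t₁) (2 * (t₁ + 2 * h)) := ⟨by linarith, by linarith⟩
  exact UniversalFactor.not_three_zeros_of_zeroFree ha0 hX hFI h₁ h₃
    (by linarith : (2 * γ₁ : ℝ) < 2 * γ₂) (by linarith : (2 * γ₂ : ℝ) < 2 * γ₃) hz₁ hz₂ hz₃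

/-- **The crux `NarrowKernelNoGo`** (stmt-RiemannHypothesis-2576), from the six stubs of the line.
[folklore] -/
theorem UniversalFactor.narrowKernelNoGo : UniversalFactor.NarrowKernelNoGo :=
  UniversalFactor.NarrowKernelNoGo_of UniversalFactor.stub_narrowConvolution
    UniversalFactor.stub_narrowEnvelope
    UniversalFactor.stub_narrowEnergyLower UniversalFactor.stub_narrowEnergyUpper
    UniversalFactor.stub_narrowShortWindow UniversalFactor.stub_narrowOrdinateZero

end Summit.RiemannHypothesis.RiemannHypothesis.Theorems
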